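import Literature.NumberTheory.LFunctions.SuzukiScrewLineRepairedThm14
import Literature.NumberTheory.LFunctions.ZetaScrewHermitianFormsProofs
import HarnessLib

/-!
# CJM Thm 4.4 (i) over the repaired screw line: `RH ⟺ (4.7)ᴿ for mean-zero test functions` — PROVED

LINE 1 — LABEL: E-class EQUIVALENCE PROVED — the FIRST conjunct of the record `Suzuki2025_thm44R`
(CJM Thm 4.4 (i): RH ⟺ `‖P̂ᴿ_φ‖² = π⟨φ,φ⟩_{G_g}` for all `φ ∈ C_c^∞(ℝ)` with `φ̂(0) = 0`); the new
content is the RH-CONSEQUENCE half (binder explicit), obtained from Thm 1.4ᴿ (`Suzuki2025_thm14R_onlyIf`)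
by the primitive `I₀` of [Su22, (3.7)]. Theorems only; no definition, no named fact. bears_on: B-C/B-P
(LADDER-RH COLUMN 6 DBR). WHAT THIS IS NOT: the SECOND conjunct of `Suzuki2025_thm44R` (RH ⟹ (4.7)ᴿ
for ALL `φ`, `φ̂(0) ≠ 0` allowed — needs the zero expansion of `⟨φ,φ⟩_{G_g}` with the `φ̂(0)` terms,
CJM (4.9)–(4.10)) is NOT proved here, so the record `Suzuki2025_thm44R` stays open (COND); proving a
criterion EQUIVALENT to RH does not move RH; nothing here bears on the truth of RH.

Source: M. Suzuki, Canad. J. Math. 2025 = arXiv:2301.00421v3, Thm 4.4 (i) (TeX l.1274–1284) and its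
proof §4.3 (TeX l.1286–1345); M. Suzuki, J. Lond. Math. Soc. 2023, (3.7) (the primitive
`I₀ : 𝔈₀(a) → C(a)`, tree `screwPrimitive`, `screwPrimitive_mem_screwTestC`,
`deriv_screwPrimitive_of_mem`).

## What is proved
* `Suzuki2025_thm44R_meanZero_onlyIf` — under RH, `‖P̂ᴿ_φ‖²_{L²} = π⟨φ,φ⟩_{G_g}` for every test `φ`
  with `∫φ = 0`: write `φ = ψ′` with `ψ = I₀φ ∈ C_c^∞` (mean zero ⇒ the primitive has compact support),
  so `Dψ = iφ`, `‖P̂ᴿ_{Dψ}‖ = ‖P̂ᴿ_φ‖` pointwise, and (1.9)ᴿ for `ψ` reads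
  `‖P̂ᴿ_φ‖² = π⟨ψ,ψ⟩_W = π⟨ψ′,ψ′⟩_{G_g}` (`zetaScrewForm_univ_deriv_eq_weilQuadratic`, CJM (4.10)).
* `Suzuki2025_thm44R_i_holds` — **CJM Thm 4.4 (i), repaired, PROVED**:
  `RiemannHypothesis ↔ ∀ φ test, ∫φ = 0 → ‖P̂ᴿ_φ‖² = π⟨φ,φ⟩_{G_g}` (`⟸` = `Suzuki2025_thm44R_mpr`).
* `Suzuki2025_thm44R_iff_clause2` — the record `Suzuki2025_thm44R` is now EQUIVALENT to its second
  clause `RH ⟹ ∀φ test, (4.7)ᴿ`.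

## References
* [Suzuki2025WeilHilbertSpace] CJM 2025 = arXiv:2301.00421v3, Thm 4.4 (TeX l.1274–1284), §4.3
  (l.1286–1345).
* [Suzuki2023] J. Lond. Math. Soc. 108 (2023), §3.3 (3.7).
-/

noncomputable section

open MeasureTheory Complex Filter Set Real
open scoped ComplexConjugate Topology

namespace Literature.NumberTheory.LFunctions

/-- **RH ⟹ (4.7)ᴿ on mean-zero test functions**: under RH, `‖P̂ᴿ_φ‖²_{L²(ℝ)} = π⟨φ,φ⟩_{G_g}` for
every `φ ∈ C_c^∞(ℝ)` with `∫φ = 0` (`φ = ψ′`, `ψ = I₀φ`; then (1.9)ᴿ for `ψ` and (4.10)).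
RH-CONSEQUENCE (binder explicit). [cite: Suzuki2025WeilHilbertSpace, Thm. 4.4 (i) `⟹` (TeX l.1274–1300); erratum E21] -/
theorem Suzuki2025_thm44R_meanZero_onlyIf (hRH : RiemannHypothesis) {φ : ℝ → ℂ}
    (hφ : IsWeilTest φ) (h0 : ∫ t : ℝ, φ t = 0) :
    ((∫ x : ℝ, ‖screwPhatR φ x‖ ^ 2 : ℝ) : ℂ) = Real.pi * zetaScrewForm univ φ φ := by
  -- `φ ∈ 𝔈₀(R)` for a support radius `R`
  obtain ⟨R, hR0, hR⟩ := hφ.2.exists_pos_le_norm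
  have hsupp : tsupport φ ⊆ Icc (-R) R := by
    refine closure_minimal (fun t ht ↦ ?_) isClosed_Icc
    by_contra htI
    apply ht
    apply hR
    rw [Real.norm_eq_abs]
    simp only [mem_Icc, not_and_or, not_le] at htI
    rcases htI with h | h
    · rw [abs_of_neg (by linarith)]; linarith
    · rw [abs_of_pos (by linarith)]; linarith
  have hmem : φ ∈ screwTestC0 R := ⟨hφ, hsupp, h0⟩
  -- the primitive `ψ = I₀ φ` is a test function with `ψ′ = φ`
  have hψC := screwPrimitive_mem_screwTestC hmem
  have hψ : IsWeilTest (screwPrimitive R 0 φ) := hψC.1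
  have hder : deriv (screwPrimitive R 0 φ) = φ := deriv_screwPrimitive_of_mem hmem
  have hD : suzukiD (screwPrimitive R 0 φ) = fun t ↦ I * φ t := by
    funext t
    simp only [suzukiD, hder]
  -- (1.9)ᴿ for `ψ`
  have h19 := Suzuki2025_thm14R_onlyIf hRH hψ
  have hnorm : ∀ x : ℝ, ‖screwPhatR (suzukiD (screwPrimitive R 0 φ)) x‖ = ‖screwPhatR φ x‖ := by
    intro x
    rw [hD, screwPhatR_const_mul, norm_mul, Complex.norm_I, one_mul]
  simp_rw [hnorm] at h19
  rw [h19, ← zetaScrewForm_univ_deriv_eq_weilQuadratic hψ, hder]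

/-- **CJM Thm 4.4 (i) over the repaired screw line — PROVED as an RH-equivalence:**
`RiemannHypothesis ↔ ∀ φ ∈ C_c^∞(ℝ), ∫φ = 0 → ‖P̂ᴿ_φ‖²_{L²(ℝ)} = π⟨φ,φ⟩_{G_g}` (`⟸` = the cell's
door `Suzuki2025_thm44R_mpr`, Weil's criterion; `⟹` = `Suzuki2025_thm44R_meanZero_onlyIf`). E-class
equivalence (COLUMN 6 DBR). [cite: Suzuki2025WeilHilbertSpace, Thm. 4.4 (i) (TeX l.1274–1284), proof §4.3 (TeX l.1286–1345); erratum E21] -/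
theorem Suzuki2025_thm44R_i_holds :
    RiemannHypothesis ↔ ∀ φ : ℝ → ℂ, IsWeilTest φ → ∫ t : ℝ, φ t = 0 →
      ((∫ x : ℝ, ‖screwPhatR φ x‖ ^ 2 : ℝ) : ℂ) = Real.pi * zetaScrewForm univ φ φ :=
  ⟨fun hRH _ hφ h0 ↦ Suzuki2025_thm44R_meanZero_onlyIf hRH hφ h0, Suzuki2025_thm44R_mpr⟩

/-- With (i) proved, the record `Suzuki2025_thm44R` is EQUIVALENT to its second clause
"RH ⟹ (4.7)ᴿ for every test function" (CJM Thm 4.4 (ii) direction, `φ̂(0) ≠ 0` allowed).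
[cite: Suzuki2025WeilHilbertSpace, Thm. 4.4 (TeX l.1274–1284); erratum E21] -/
theorem Suzuki2025_thm44R_iff_clause2 :
    Suzuki2025_thm44R ↔ (RiemannHypothesis → ∀ φ : ℝ → ℂ, IsWeilTest φ →
      ((∫ x : ℝ, ‖screwPhatR φ x‖ ^ 2 : ℝ) : ℂ) = Real.pi * zetaScrewForm univ φ φ) :=
  ⟨fun h ↦ h.2, fun h ↦ ⟨Suzuki2025_thm44R_i_holds, h⟩⟩

end Literature.NumberTheory.LFunctions
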